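import Summits.KontsevichZagierPeriods.KontsevichZagierPeriods.Theorems.HurwitzMicroSectorsNormalFormPrincipleL2W3Carriers
import Summits.KontsevichZagierPeriods.KontsevichZagierPeriods.Theorems.HurwitzMicroSectorsNormalFormPrincipleL2W3ExistsChartTargets
import Summits.KontsevichZagierPeriods.KontsevichZagierPeriods.Theorems.HurwitzMicroSectorsNormalFormPrincipleM3EbdBoxSubSimplex
import Summits.KontsevichZagierPeriods.KontsevichZagierPeriods.Theorems.HurwitzMicroSectorsNormalFormPrincipleL2W3RelationsDilation
import Summits.KontsevichZagierPeriods.KontsevichZagierPeriods.Theorems.HurwitzMicroSectorsNormalFormPrincipleL2W3RelationsMoebiusOne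
import Summits.KontsevichZagierPeriods.KontsevichZagierPeriods.Theorems.HurwitzMicroSectorsNormalFormPrincipleL2W3RelationsMoebiusTwo
import Summits.KontsevichZagierPeriods.KontsevichZagierPeriods.Theorems.HurwitzMicroSectorsNormalFormPrincipleL2W3RelationsMoebiusThree
import Summits.KontsevichZagierPeriods.KontsevichZagierPeriods.Theorems.HurwitzMicroSectorsNormalFormPrincipleL2W3RelationsReflection

/-!
# `NormalFormPrinciple` (stmt-KontsevichZagierPeriods-3869), line `SketchIdeator1` —
# leaf `stub_boxRigidity` in DIMENSION THREE: HalfPointDuality `[(0,1)³, 2/((2−xy)(2−xyz))] ∼ [(0,1)³, 1/((1+x)(1+xyz))]`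

Assembly file (layer `L2W3`, lead seat c9; `--supports` the crux) of a target of the crux idea
`m3-equal-value-instances` (strategist gen 2): a half-point box and an alternating box with the same
value `0.6319661978…`. Chain: simplex charts (`[aad] + [add]` vs `[aac] − [cac]`), two reflection moves
(`[aad] = [cbb]`, `[add] = [ccb]`), two Möbius moves (`rel3`: `∫aac = ∫cbb + ∫cbc + ∫ccb + ∫ccc`,
`rel7`: `∫cac = ∫cbc + ∫ccc`), whose difference is exactly the claim. Four rule-(2) moves beyond the
charts; no independence input. Sources: M. Kontsevich, D. Zagier, *Periods* (2001), §1.2.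
No definitions are introduced.
-/

noncomputable section

open MeasureTheory Set
open Literature.NumberTheory.Transcendental Literature.NumberTheory.Transcendental.KZ
open Literature.ModelTheory.ExponentialFields (IsSemialgebraic)
open Summit.KontsevichZagierPeriods.HyperbolicBloch.OffTetraSectorKernel
  (aff_orbit_of_sub_sum_zsmul_mem_relations)

namespace Summit.KontsevichZagierPeriods.HurwitzMicroSectors.NormalFormPrinciple.PiBox.M3

/-- **HalfPointDuality (`StrategistGen2.HalfPointDuality`, crux idea `m3-equal-value-instances`;
registered sub-goal of stmt-KontsevichZagierPeriods-3869, line `SketchIdeator1`, layer `L2W3`).** Any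
representation of `[(0,1)³, 2/((2−xy)(2−xyz))]` is KZ-equivalent to any representation of
`[(0,1)³, 1/((1+x)(1+xyz))]` (common value `0.63196619…`): the box charts give `[aad] + [add]` and
`[aac] − [cac]`; two reflection moves (`[aad] = [cbb]`, `[add] = [ccb]`) and two Möbius moves
(`rel3 − rel7`) close it. [cite: KontsevichZagier2001, §1.2 rules (1), (2)] -/
theorem halfPointDuality (r r' : IntegralRep 3)
    (hrd : r.domain = {x | ∀ i, x i ∈ Set.Ioo (0:ℝ) 1})
    (hri : EqOn r.integrand (fun x => 2 / ((2 - x 0 * x 1) * (2 - x 0 * x 1 * x 2))) {x | ∀ i, x i ∈ Set.Ioo (0:ℝ) 1})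
    (hr'd : r'.domain = {x | ∀ i, x i ∈ Set.Ioo (0:ℝ) 1})
    (hr'i : EqOn r'.integrand (fun x => 1 / ((1 + x 0) * (1 + x 0 * x 1 * x 2))) {x | ∀ i, x i ∈ Set.Ioo (0:ℝ) 1}) :
    Equivalent r r' := by
  obtain ⟨AAB, ABB, AAC, ACC, ABC, ACB, CBB, CBC, CCB, CCC, CAB, CAC, AAD, DAD, ADD, DAB,
    ⟨hAABd, hAABi⟩, ⟨hABBd, hABBi⟩, ⟨hAACd, hAACi⟩, ⟨hACCd, hACCi⟩, ⟨hABCd, hABCi⟩, ⟨hACBd, hACBi⟩,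
    ⟨hCBBd, hCBBi⟩, ⟨hCBCd, hCBCi⟩, ⟨hCCBd, hCCBi⟩, ⟨hCCCd, hCCCi⟩, ⟨hCABd, hCABi⟩, ⟨hCACd, hCACi⟩,
    ⟨hAADd, hAADi⟩, ⟨hDADd, hDADi⟩, ⟨hADDd, hADDi⟩, ⟨hDABd, hDABi⟩⟩ := l2w3_carriers
  obtain ⟨⟨G1, hG1d, hG1i⟩, ⟨G2, hG2d, hG2i⟩, ⟨G3, hG3d, hG3i⟩, ⟨G4, hG4d, hG4i⟩, ⟨G5, hG5d, hG5i⟩,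
    ⟨G6, hG6d, hG6i⟩⟩ := l2w3_exists_chartTargets
  have e0 : of r - of G4 ∈ relations := by
    refine ebd_box_sub_simplex (fun t => 2 / (t 0 * t 1 * (2 - t 1) * (2 - t 2))) r G4 hrd hG4d
      (hG4i ▸ fun _ _ => rfl) fun x hx => ?_
    have hx' : ∀ i, x i ∈ Set.Ioo (0:ℝ) 1 := by rw [hrd] at hx; exact hx
    have h0 : x 0 ≠ 0 := (hx' 0).1.ne'
    have h1 : x 1 ≠ 0 := (hx' 1).1.ne'
    have h2p : 2 - x 0 * x 1 * x 2 ≠ 0 := by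
      have := mul_lt_one_of_nonneg_of_lt_one_left (mul_pos (hx' 0).1 (hx' 1).1).le
        (mul_lt_one_of_nonneg_of_lt_one_left (hx' 0).1.le (hx' 0).2 (hx' 1).2.le) (hx' 2).2.le
      linarith
    have h2q : 2 - x 0 * x 1 ≠ 0 := by
      have := mul_lt_one_of_nonneg_of_lt_one_left (hx' 0).1.le (hx' 0).2 (hx' 1).2.le
      linarith
    rw [hri hx']
    simp only [Matrix.cons_val_zero, Matrix.cons_val_one, Matrix.cons_val_two, Matrix.head_cons,
      Matrix.tail_cons]
    field_simp
  have e0' : of G4 - ((1:ℤ) • of AAD + (1:ℤ) • of ADD) ∈ relations := by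
    have h := aff_orbit_of_sub_sum_zsmul_mem_relations (Finset.univ : Finset (Fin 2))
      ![AAD, ADD] ![1, 1] G4 (fun i _ => by
        fin_cases i
        · exact hAADd.trans hG4d.symm
        · exact hADDd.trans hG4d.symm) fun t ht => ?_
    · simpa [Fin.sum_univ_two, add_assoc] using h
    have hf := l2v_simplex_facts (hG4d ▸ ht)
    simp only [Fin.sum_univ_two, Matrix.cons_val_zero, Matrix.cons_val_one, hG4i, hAADi, hADDi]
    have h0 : t 0 ≠ 0 := hf.1.ne'
    have h0a : 1 - t 0 ≠ 0 := by linarith [hf.2.1]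
    have h0b : 1 + t 0 ≠ 0 := by linarith [hf.1]
    have h0c : 2 - t 0 ≠ 0 := by linarith [hf.2.1]
    have h1 : t 1 ≠ 0 := hf.2.2.1.ne'
    have h1a : 1 - t 1 ≠ 0 := by linarith [hf.2.2.2.1]
    have h1b : 1 + t 1 ≠ 0 := by linarith [hf.2.2.1]
    have h1c : 2 - t 1 ≠ 0 := by linarith [hf.2.2.2.1]
    have h2a : 1 - t 2 ≠ 0 := by linarith [hf.2.2.2.2.2]
    have h2b : 1 + t 2 ≠ 0 := by linarith [hf.2.2.2.2.1]
    have h2c : 2 - t 2 ≠ 0 := by linarith [hf.2.2.2.2.2]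
    push_cast
    field_simp
    ring
  have e1 : of r' - of G5 ∈ relations := by
    refine ebd_box_sub_simplex (fun t => 1 / (t 0 * (1 + t 0) * t 1 * (1 + t 2))) r' G5 hr'd hG5d
      (hG5i ▸ fun _ _ => rfl) fun x hx => ?_
    have hx' : ∀ i, x i ∈ Set.Ioo (0:ℝ) 1 := by rw [hr'd] at hx; exact hx
    have h0 : x 0 ≠ 0 := (hx' 0).1.ne'
    have h1 : x 1 ≠ 0 := (hx' 1).1.ne'
    have h012 : 1 + x 0 * x 1 * x 2 ≠ 0 := by
      nlinarith [(hx' 0).1, (hx' 1).1, (hx' 2).1, mul_pos (hx' 0).1 (hx' 1).1]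
    have hp0 : 1 + x 0 ≠ 0 := by linarith [(hx' 0).1]
    rw [hr'i hx']
    simp only [Matrix.cons_val_zero, Matrix.cons_val_one, Matrix.cons_val_two, Matrix.head_cons,
      Matrix.tail_cons]
    field_simp
  have e1' : of G5 - ((1:ℤ) • of AAC + (-1:ℤ) • of CAC) ∈ relations := by
    have h := aff_orbit_of_sub_sum_zsmul_mem_relations (Finset.univ : Finset (Fin 2))
      ![AAC, CAC] ![1, -1] G5 (fun i _ => by
        fin_cases i
        · exact hAACd.trans hG5d.symm
        · exact hCACd.trans hG5d.symm) fun t ht => ?_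
    · simpa [Fin.sum_univ_two, add_assoc] using h
    have hf := l2v_simplex_facts (hG5d ▸ ht)
    simp only [Fin.sum_univ_two, Matrix.cons_val_zero, Matrix.cons_val_one, hG5i, hAACi, hCACi]
    have h0 : t 0 ≠ 0 := hf.1.ne'
    have h0a : 1 - t 0 ≠ 0 := by linarith [hf.2.1]
    have h0b : 1 + t 0 ≠ 0 := by linarith [hf.1]
    have h0c : 2 - t 0 ≠ 0 := by linarith [hf.2.1]
    have h1 : t 1 ≠ 0 := hf.2.2.1.ne'
    have h1a : 1 - t 1 ≠ 0 := by linarith [hf.2.2.2.1]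
    have h1b : 1 + t 1 ≠ 0 := by linarith [hf.2.2.1]
    have h1c : 2 - t 1 ≠ 0 := by linarith [hf.2.2.2.1]
    have h2a : 1 - t 2 ≠ 0 := by linarith [hf.2.2.2.2.2]
    have h2b : 1 + t 2 ≠ 0 := by linarith [hf.2.2.2.2.1]
    have h2c : 2 - t 2 ≠ 0 := by linarith [hf.2.2.2.2.2]
    push_cast
    field_simp
    ring
  have rel3 : of CBB + of CBC + of CCB + of CCC - of AAC ∈ relations :=
    l2w3_relations_moebius_one.1 AAC hAACd hAACi CBB hCBBd hCBBi CBC hCBCd hCBCi CCB hCCBd hCCBi CCC hCCCd hCCCi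
  have rel7 : of CBC + of CCC - of CAC ∈ relations :=
    l2w3_relations_moebius_two.2.1 CAC hCACd hCACi CBC hCBCd hCBCi CCC hCCCd hCCCi
  have conv1 : of AAD - of CBB ∈ relations := l2w3_relations_reflection.2.1 CBB hCBBd hCBBi AAD hAADd hAADi
  have conv3 : of ADD - of CCB ∈ relations := l2w3_relations_reflection.2.2.2.1 CCB hCCBd hCCBi ADD hADDd hADDi
  have key : ((1:ℤ) • of AAD + (1:ℤ) • of ADD) - ((1:ℤ) • of AAC + (-1:ℤ) • of CAC) =
      (of AAD - of CBB) + (of ADD - of CCB)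
      + ((of CBB + of CBC + of CCB + of CCC - of AAC) - (of CBC + of CCC - of CAC)) := by
    simp only [one_smul, neg_smul]
    abel
  have hmid : ((1:ℤ) • of AAD + (1:ℤ) • of ADD) - ((1:ℤ) • of AAC + (-1:ℤ) • of CAC) ∈ relations := by
    rw [key]
    exact relations.add_mem (relations.add_mem conv1 conv3) (relations.sub_mem rel3 rel7)
  have e : of r - of r' = (of r - of G4) + (of G4 - ((1:ℤ) • of AAD + (1:ℤ) • of ADD))
      + (((1:ℤ) • of AAD + (1:ℤ) • of ADD) - ((1:ℤ) • of AAC + (-1:ℤ) • of CAC))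
      - (of G5 - ((1:ℤ) • of AAC + (-1:ℤ) • of CAC)) - (of r' - of G5) := by abel
  show of r - of r' ∈ relations
  rw [e]
  exact relations.sub_mem (relations.sub_mem (relations.add_mem (relations.add_mem e0 e0') hmid) e1') e1

end Summit.KontsevichZagierPeriods.HurwitzMicroSectors.NormalFormPrinciple.PiBox.M3
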